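import Mathlib
import Literature.Geometry.DiscreteGeometry.DelaunaySubdivision
import Summits.AtomisticToContinuum.Crystallization.Theorems.SquareWellLayerCakeAveragedTwelveNearTriangle
import HarnessLib

/-!
# Line `Sketch` (par-five-delaunay-recount), crux `SquareWellLayerCake.AveragedTwelve`
# (stmt-AtomisticToContinuum-15806): NEAR SIMPLICES ARE DELAUNAY (`stub_nearSimplex`)

Uniform-weight corollary of the Huygens engine
`ParFiveRecountNearTriangle.mem_faces_of_sum_mul_dist_sq_lt` (landed with `stub_nearTriangle`): in a
Delaunay triangulation of a `d`-separated `ω ⊂ ℝ³`, every non-empty set `t` of at most four sites with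
pairwise distances `≤ (57/50) d` is a simplex of the triangulation — the second moment of the uniform
distribution on `t` about any of its points is `≤ ((#t − 1)/#t)(57/50)² d² ≤ (3/4)(1.2996) d² < d²`.
Consequences for the line: quasi-regular tetrahedra (all six edges in `[d, (57/50)d]`) are cells of EVERY
Delaunay triangulation, and the close link vertices of a near edge are exactly the common near neighbours of
its endpoints, so "all-near vertex", "lens count `c_e`" and the alphabet statements are intrinsic.
-/

noncomputable section

open scoped BigOperators Classical

namespace Summit.AtomisticToContinuum.Crystallization.Theorems.ParFiveRecountNearSimplex

open Literature.Geometry.DiscreteGeometry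
open Summit.AtomisticToContinuum.Crystallization.Theorems.ParFiveRecountNearTriangle
  (mem_faces_of_sum_mul_dist_sq_lt)

/-- **Near simplices are Delaunay** (registered stub `stub_nearSimplex` of line `Sketch`). -/
theorem stub_nearSimplex : ∀ (d : ℝ), 0 < d → ∀ (ω : Set (EuclideanSpace ℝ (Fin 3))) (K : Geometry.SimplicialComplex ℝ (EuclideanSpace ℝ (Fin 3))), Literature.Geometry.DiscreteGeometry.IsDelaunayTriangulation ω K → (∀ x ∈ ω, ∀ y ∈ ω, x ≠ y → d ≤ dist x y) → ∀ (t : Finset (EuclideanSpace ℝ (Fin 3))), t.Nonempty → t.card ≤ 4 → (∀ a ∈ t, a ∈ ω) → (∀ a ∈ t, ∀ b ∈ t, dist a b ≤ 57 / 50 * d) → t ∈ K.faces := by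
  intro d hd ω K hK hsep t htne htcard htω hnear
  have hd2 : 0 < d ^ 2 := by positivity
  have hk0 : (0 : ℝ) < t.card := by exact_mod_cast htne.card_pos
  refine mem_faces_of_sum_mul_dist_sq_lt hK hd hsep htne htω (μ := fun _ => 1 / (t.card : ℝ))
    (fun _ _ => by positivity) ?_ ?_
  · rw [Finset.sum_const, nsmul_eq_mul]; field_simp
  · intro s₀ hs₀
    have hle : ∀ s ∈ t, (1 / (t.card : ℝ)) * dist s s₀ ^ 2 ≤
        (1 / (t.card : ℝ)) * (if s = s₀ then 0 else (57 / 50 * d) ^ 2) := by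
      intro s hs
      refine mul_le_mul_of_nonneg_left ?_ (by positivity)
      split_ifs with h
      · rw [h, dist_self]; norm_num
      · exact pow_le_pow_left₀ dist_nonneg (hnear s hs s₀ hs₀) 2
    refine (Finset.sum_le_sum hle).trans_lt ?_
    rw [← Finset.mul_sum, Finset.sum_ite, Finset.sum_const_zero, zero_add, Finset.sum_const,
      nsmul_eq_mul]
    have hfilt : (t.filter fun s => ¬ s = s₀).card = t.card - 1 := by
      rw [Finset.filter_ne', Finset.card_erase_of_mem hs₀]
    rw [hfilt]
    have hcard4 : (t.card : ℝ) ≤ 4 := by exact_mod_cast htcard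
    have hsub : (((t.card - 1 : ℕ)) : ℝ) = t.card - 1 := by
      rw [Nat.cast_sub htne.card_pos, Nat.cast_one]
    rw [hsub, div_mul_eq_mul_div, one_mul, div_lt_iff₀ hk0]
    nlinarith
end Summit.AtomisticToContinuum.Crystallization.Theorems.ParFiveRecountNearSimplex

end
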